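import Summits.BirchSwinnertonDyer.BirchSwinnertonDyer.Theorems.AlignedTransportAtTwoMainConjectureOfRankZeroBSDAtTwoTwoFixedPointLambdaParity
import Summits.BirchSwinnertonDyer.BirchSwinnertonDyer.Theorems.AlignedTransportAtTwoMainConjectureOfRankZeroBSDAtTwoOffStratumChi8Twist
import Literature.Barriers.BirchSwinnertonDyer.PAdicFunctionalEquationParityProofs
import Summits.BirchSwinnertonDyer.Rank1Residual.Supersingular.SignedLambdaParityTwoMazurTate
import Literature.NumberTheory.EllipticCurves.PAdicLFunctionIntegralityAtTwoAutoProofs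
import Summits.BirchSwinnertonDyer.Rank1Residual.F1Sign2.AnalyticLineTransferAtTwo
import Mathlib.AlgebraicGeometry.EllipticCurve.Reduction
import HarnessLib

/-!
# Route `AlignedTransportAtTwo`, crux C2 `MainConjectureOfRankZeroBSDAtTwo` (stmt-BirchSwinnertonDyer-22298):
# THE `2`-ADIC `L`-FUNCTION OF EVERY CURVE ON THE CUBIC CHEVALLEY ROAD VANISHES TO ODD ORDER AT THE ORDER-2
# CHARACTER `T = −2` AND HAS ODD `λ` — the three parity laws `(−1)^{ord₀ L₂} = w(W)`, `(−1)^{λ₂} = χ₈(N_W)`,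
# `(−1)^{ord₋₂ L₂} = w(W)·χ₈(N_W)` for good ordinary `W/ℚ` at `2`, KERNEL, from the functional equation alone

HONEST FRAMING (cell `bsd-f1-sign2`, WIDTH-5 attached prover seat `bsd-line-att-p5` gen 33 on line `birth` of the lead
`bsd-line-att-p2`; `--supports` stmt-BirchSwinnertonDyer-22298, closes nothing; BSD is NOT proved by any of this; the crux C2, its
verdict «blocked-on `Rank1Residual.GreenbergMuConjectureIrreducible`» and every registered stub are untouched). THEOREMS ONLY (no `def`,
no named fact, no `sorry`). EVERY input is a tree THEOREM: the conductor-level functional equation of the Mazur–Tate–Teitelbaum `2`-adic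
`L`-function `L₂(W,T) = padicLFunction f (unitRoot W 2)` WITH its exponent (`exists_exponent_subst_padicLFunction_eq_conductorLevel`,
barrier file `PAdicFunctionalEquationParityProofs`, proved at every `p` including `2`), `N ≡ ±5^e ⇒ (−1)^{e mod 2} = χ₈(N)`
(`Supersingular.neg_one_pow_val_eq_chi8`), integrality of `L₂` (`exists_iwasawaToPowerSeries_eq_padicLFunction_two_auto`), the
two-fixed-points algebra of the companion files `…TwoFixedPointLemma` / `…TwoFixedPointLambdaParity` (this seat), and att-p5 g32's
`N_W ≡ |Δ_min| (mod 8)` on Tam-odd rows (`…OffStratumChi8Twist`). The one appearance of the Modularity Theorem (`exists_isNewformOf`,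
binder `hmod`) is in the optional reading `= w(W^{(2)})` of §3; everything else holds for any `W` with a newform `f ∈ S₂(Γ₀(N_W))`.

THE LAWS. Let `W/ℚ` be globally minimal, good ordinary at `2`, `f` its newform at level `N_W`, and `g ∈ ℤ₂⟦T⟧` ANY integral model of
a scalar multiple `c·L₂(W,T)` (`ι g = C c · L₂`; e.g. the integral lift, or `2^{−μ} L₂`). §1: `g(T^ι) = w(W)(1+T)^e g` in `ℤ₂⟦T⟧` with
`(−1)^{e mod 2} = χ₈(N_W)`. §2: **`(−1)^{ord_{T=0} g} = w(W)`** (Greenberg's sign comparison), **`(−1)^{λ(g)} = χ₈(N_W)`** (the tree's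
PARITY(2) `even_firstUnitCoeff_iff_conductorNorm_mod_eight`, here in `λ`-language from `[T¹](w(1+T)^e) = we ≡ λ (mod 2)`), and the
new one **`(−1)^{ord_{T=−2} g} = w(W)·χ₈(N_W)`** — `2`-ADIC PARITY AT THE ORDER-2 CHARACTER: `L₂(W,T)` vanishes at `T = −2` (the
character `χ₈` of the first layer `ℚ(√2)`, `γ = 5 ↦ −1`) to even order iff the sign of `W ⊗ χ₈` is `+1`. §3: on Tam-odd rows
`(−1)^{ord₋₂ g} = χ₈(|Δ_min|)·w(W)` (`= w(W^{(2)})` under `hmod`), `(−1)^{λ(g)} = χ₈(|Δ_min|)`. §4, THE ROAD (`Δ_min ≡ 3, 5 (mod 8)`,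
`∏ c_v` odd, `r_an(W) = 0`, so `w(W) = 1` unconditionally): **`ord_{T=−2} g` is ODD, `(T + 2) ∣ g`, `λ(g)` is ODD, `ord_{T=0} g` is
even** — for EVERY integral model, in particular for the integral lift of `L₂(W,T)` itself (`exists_integral_lift_of_road`). This is the
Iwasawa half of crux memo CHI8-TWIST-att-p5-g32 §2 («`(T+2) ∣ L₂`, `λ₂` odd ≥ 3», verified there on 19/19 road curves by a modular-symbol
engine) made KERNEL, and sharper: not only `(T+2) ∣ L₂` (which the tree's `X_add_C_two_dvd_of_analyticRank_quadraticTwist_two_ne_zero`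
also gives, through MTT interpolation at `χ₈` and `L(W^{(2)},1) = 0`) but the ORDER at `−2` is odd, with no interpolation property used.
READING (for the -imc ledger, not typed): with `μ₂ = 0` and the Euler-characteristic value `ord₂ L₂(W,0) = 2·ord₂ #Ẽ(𝔽₂) ∈ {2,4}`
(rank `0`, `Ш₂ = 1`, `∏ c_v` odd) the excess `λ₂ − ord₋₂ ≥ 2` is even: the zeros away from `0, −2` come in `ι`-pairs.

presearch: as in the companion files (Greenberg LNM 1716 p. 181 remark; tree barrier files `PAdicFunctionalEquationParity*`): the order-2
character parity law for ORDINARY `2`-adic `L`-functions is not printed as such (REF2 v60 §7/§10: twist-sign formula and Sprung's FEs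
KNOWN; «`T = −2` zero PRINT-ASSEMBLY»). KNOWN frame (MTT FE + sign of the `χ₈`-twist); beyond-print theorem: no.

References: R. Greenberg, LNM 1716 (1999), §1 pp. 67–68, §5 p. 181 [GreenbergLNM1716]; B. Mazur, J. Tate, J. Teitelbaum, Invent. Math.
84 (1986) §I.12–I.13, §I.17 [MazurTateTeitelbaum1986Invent]; M. R. Murty, V. K. Murty, *Non-vanishing of L-functions* (1997) Ch. 6 §1
[MurtyMurty1997]; J. Silverman, *Advanced Topics*, IV.9 Table 4.1 [SilvermanATAEC1994].
-/

set_option linter.dupNamespace false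
set_option autoImplicit false

noncomputable section

open scoped Classical MatrixGroups ModularForm

namespace Summit.BirchSwinnertonDyer.BirchSwinnertonDyer.Theorems.AlignedTransportAtTwoRoadSecondFixedPoint

open PowerSeries CongruenceSubgroup WeierstrassCurve Literature.NumberTheory.EllipticCurves
  Literature.NumberTheory.EllipticCurves.ModularForms Literature.Barriers.BirchSwinnertonDyer
  Summit.BirchSwinnertonDyer.Rank1Residual.Supersingular Summit.BirchSwinnertonDyer.Rank1Residual.F1Sign2
  Summit.BirchSwinnertonDyer.Rank1Residual.X1.MuLambda
  Summit.BirchSwinnertonDyer.BirchSwinnertonDyer.Theorems.AlignedTransportAtTwoTwoFixedPoints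
  Summit.BirchSwinnertonDyer.BirchSwinnertonDyer.Theorems.AlignedTransportAtTwoOffStratumChi8Twist

/-! ## §1 The INTEGRAL functional equation of `L₂(W, T)` with its exponent -/

/-- The binomial series with a `2`-adic integer exponent maps to the same series over `ℚ₂`. [folklore] -/
theorem map_binomialSeries_padicInt (e : ℤ_[2]) :
    PowerSeries.map (algebraMap ℤ_[2] ℚ_[2]) (binomialSeries ℤ_[2] e) = binomialSeries ℚ_[2] e := by
  ext n
  rw [coeff_map, binomialSeries_coeff, binomialSeries_coeff, smul_eq_mul, mul_one, Algebra.smul_def, mul_one]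

/-- **Transport of a functional equation to an integral model.** If `g ∈ ℤ₂⟦T⟧` maps to `c · L` in `ℚ₂⟦T⟧` and
`L(T^ι) = w (1+T)^e L` there (`w ∈ ℤ`, `e ∈ ℤ₂`), then `g(T^ι) = (w (1+T)^e)·g` in `ℤ₂⟦T⟧` (`ℤ₂⟦T⟧ ↪ ℚ₂⟦T⟧` is injective
and commutes with `ι`). [cite: GreenbergLNM1716, §1 (functional equation, pp. 67–68)] -/
theorem subst_eq_mul_of_map_eq {g : PowerSeries ℤ_[2]} {c : ℚ_[2]} {L : PowerSeries ℚ_[2]} {w : ℤ} {e : ℤ_[2]}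
    (hg : iwasawaToPowerSeries 2 g = C c * L)
    (hFE : L.subst (invOnePlusSubOne : PowerSeries ℚ_[2]) = C ((w : ℤ) : ℚ_[2]) * binomialSeries ℚ_[2] e * L) :
    g.subst (invOnePlusSubOne : PowerSeries ℤ_[2]) =
      (C ((w : ℤ) : ℤ_[2]) * binomialSeries ℤ_[2] e) * g := by
  apply iwasawaToPowerSeries_injective 2
  have hg' : PowerSeries.map (algebraMap ℤ_[2] ℚ_[2]) g = C c * L := hg
  have h1 : PowerSeries.map (algebraMap ℤ_[2] ℚ_[2]) (g.subst (invOnePlusSubOne : PowerSeries ℤ_[2])) =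
      (PowerSeries.map (algebraMap ℤ_[2] ℚ_[2]) g).subst (invOnePlusSubOne : PowerSeries ℚ_[2]) := by
    rw [← map_invOnePlusSubOne (algebraMap ℤ_[2] ℚ_[2])]
    exact PowerSeries.map_subst hasSubst_invOnePlusSubOne g
  show PowerSeries.map (algebraMap ℤ_[2] ℚ_[2]) (g.subst (invOnePlusSubOne : PowerSeries ℤ_[2])) =
    PowerSeries.map (algebraMap ℤ_[2] ℚ_[2]) ((C ((w : ℤ) : ℤ_[2]) * binomialSeries ℤ_[2] e) * g)
  rw [h1, map_mul, map_mul, PowerSeries.map_C, map_intCast, map_binomialSeries_padicInt, hg', ← smul_eq_C_mul,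
    subst_smul hasSubst_invOnePlusSubOne c L, hFE, smul_eq_C_mul, smul_eq_C_mul]
  ring

variable {W : WeierstrassCurve ℚ} [W.IsElliptic] [W.IsGloballyMinimal] [NeZero (W.conductorNorm ℤ)]
  {f : CuspForm (Gamma0 (W.conductorNorm ℤ)) 2}

/-- **The integral functional equation of the `2`-adic `L`-function, with the parity of its exponent.** For `W/ℚ` globally minimal,
good ordinary at `2`, `f ∈ S₂(Γ₀(N_W))` its newform, and ANY `g ∈ ℤ₂⟦T⟧` mapping to a scalar multiple `c·L₂(W,T)` of the tree's
`2`-adic `L`-function `padicLFunction f (unitRoot W 2)` (e.g. its integral lift, `exists_iwasawaToPowerSeries_eq_padicLFunction_two_auto`,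
or `2^{−μ}` times it): there is `e ∈ ℤ₂` with **`g(T^ι) = w(W)·(1+T)^e·g(T)`** and **`(−1)^{e mod 2} = χ₈(N_W)`** — the tree's
conductor-level functional equation `exists_exponent_subst_padicLFunction_eq_conductorLevel` (Mazur–Tate–Teitelbaum §I.17 / Greenberg §1,
PROVED in the tree at every `p` including `2`) transported to `ℤ₂⟦T⟧`, and `N_W ≡ ±5^e (mod 8)` read through `neg_one_pow_val_eq_chi8`.
[cite: GreenbergLNM1716, §1 (functional equation, pp. 67–68)] -/
theorem exists_integral_functional_equation (hord : IsOrdinaryAt W 2) (hf : IsNewformOf W f)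
    {c : ℚ_[2]} {g : PowerSeries ℤ_[2]} (hg : iwasawaToPowerSeries 2 g = C c * padicLFunction f (unitRoot W 2 : ℚ_[2])) :
    ∃ e : ℤ_[2], (-1 : ℤ) ^ (PadicInt.toZModPow 1 e).val = ZMod.χ₈ ((W.conductorNorm ℤ : ℕ) : ZMod 8) ∧
      g.subst (invOnePlusSubOne : PowerSeries ℤ_[2]) =
        (C ((W.rootNumber : ℤ) : ℤ_[2]) * binomialSeries ℤ_[2] e) * g := by
  obtain ⟨ηN, e, hc, hFE⟩ := exists_exponent_subst_padicLFunction_eq_conductorLevel (p := 2) hord hf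
  exact ⟨e, neg_one_pow_val_eq_chi8 (n := 1) le_rfl (hc 1), subst_eq_mul_of_map_eq hg hFE⟩

/-! ## §2 The three parity laws of `L₂(W, T)`: at `T = 0`, at `T = −2`, and for `λ` -/

/-- The constant term of the multiplier `w·(1+T)^e` is `w`. [folklore] -/
theorem constantCoeff_multiplier (w : ℤ) (e : ℤ_[2]) :
    constantCoeff (C ((w : ℤ) : ℤ_[2]) * binomialSeries ℤ_[2] e) = (w : ℤ_[2]) := by
  rw [map_mul, constantCoeff_C, binomialSeries_constantCoeff, mul_one]

/-- The `T`-coefficient of the multiplier `w·(1+T)^e` is `w·e`. [folklore] -/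
theorem coeff_one_multiplier (w : ℤ) (e : ℤ_[2]) :
    coeff 1 (C ((w : ℤ) : ℤ_[2]) * binomialSeries ℤ_[2] e) = (w : ℤ_[2]) * e := by
  rw [coeff_C_mul, binomialSeries_coeff, Ring.choose_one_right, smul_eq_mul, mul_one]

/-- **Parity at the trivial character: `(−1)^{ord_{T=0} g} = w(W)`** for every integral model `g` of `c·L₂(W,T)` (Greenberg's sign
comparison; the tree's `rootNumber_eq_neg_one_pow_order_padicLFunction` for `L₂` itself over `ℚ₂`). [cite: GreenbergLNM1716, §5 p. 181] -/
theorem neg_one_pow_orderAtZero_eq_rootNumber (hord : IsOrdinaryAt W 2) (hf : IsNewformOf W f)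
    {c : ℚ_[2]} {g : PowerSeries ℤ_[2]} (hg : iwasawaToPowerSeries 2 g = C c * padicLFunction f (unitRoot W 2 : ℚ_[2]))
    {m : ℕ} (hm : HasOrderAtZero g m) : (-1 : ℤ) ^ m = W.rootNumber := by
  obtain ⟨e, -, hFE⟩ := exists_integral_functional_equation hord hf hg
  have h := neg_one_pow_eq_constantCoeff_of_hasOrderAtZero hFE hm
  rw [constantCoeff_multiplier] at h
  exact_mod_cast h

/-- **PARITY(2) in `λ`-language: `(−1)^{λ(g)} = χ₈(N_W)`** for every non-zero integral model `g` of `c·L₂(W,T)` (`λ` = the tree's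
`X1.MuLambda.lam`, the Weierstrass degree of `g/2^{μ(g)}`) — from `[T¹](w(1+T)^e) = w·e ≡ λ(g) (mod 2)` (part 2, §7) and
`(−1)^{e mod 2} = χ₈(N_W)`. (The tree's `even_firstUnitCoeff_iff_conductorNorm_mod_eight` is the same law phrased with the first unit
coefficient of `t·L₂`.) [cite: GreenbergLNM1716, §1 (functional equation and ⟨N_E⟩, pp. 67–68) and §5 p. 181] -/
theorem neg_one_pow_lam_eq_χ₈_conductorNorm (hord : IsOrdinaryAt W 2) (hf : IsNewformOf W f)
    {c : ℚ_[2]} {g : PowerSeries ℤ_[2]} (hg : iwasawaToPowerSeries 2 g = C c * padicLFunction f (unitRoot W 2 : ℚ_[2]))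
    (hg0 : g ≠ 0) : (-1 : ℤ) ^ lam g = ZMod.χ₈ ((W.conductorNorm ℤ : ℕ) : ZMod 8) := by
  obtain ⟨e, hχ, hFE⟩ := exists_integral_functional_equation hord hf hg
  obtain ⟨h0, h1⟩ := residue_constantCoeff_and_coeff_one hg0 hFE
  rw [constantCoeff_multiplier] at h0
  rw [coeff_one_multiplier, map_mul, h0, one_mul] at h1
  -- `e ≡ λ (mod 2)`
  have hker : e - (lam g : ℤ_[2]) ∈ RingHom.ker (PadicInt.toZModPow (p := 2) 1) := by
    rw [PadicInt.ker_toZModPow, pow_one, ← PadicInt.maximalIdeal_eq_span_p, ← IsLocalRing.residue_eq_zero_iff,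
      map_sub, h1, map_natCast, sub_self]
  rw [RingHom.mem_ker, map_sub, map_natCast, sub_eq_zero] at hker
  have hval : (PadicInt.toZModPow 1 e).val = lam g % 2 := by
    rw [hker, ZMod.val_natCast, pow_one]
  rw [← hχ, hval]
  exact neg_one_pow_eq_pow_mod_two (R := ℤ) (lam g)

/-- **Parity at the order-2 character: `(−1)^{ord_{T=−2} g} = w(W)·χ₈(N_W)`** for every integral model `g` of `c·L₂(W,T)` —
the `2`-adic `L`-function of a good ordinary `W/ℚ` vanishes at `T = −2` (the character `χ₈` of the first layer `ℚ(√2)` of the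
cyclotomic `ℤ₂`-extension, `γ = 5 ↦ −1`) to EVEN order iff `w(W)·χ₈(N_W) = +1`, i.e. iff the sign of `W ⊗ χ₈` is `+1` (for `N_W` odd
`w(W ⊗ χ₈) = χ₈(N_W)·w(W)`, tree `rootNumber_quadraticTwist_two`). Inputs: the integral functional equation (§1), the two-fixed-points
algebra `(−1)^{ord₋₂ g} = v(−2) = (−1)^{λ(g)}·v(0)` (parts 1–2) and `(−1)^{λ(g)} = χ₈(N_W)`. No interpolation property at `χ₈` is used.
[cite: GreenbergLNM1716, §5 p. 181] -/
theorem neg_one_pow_orderAtNegTwo_eq_rootNumber_mul_χ₈ (hord : IsOrdinaryAt W 2) (hf : IsNewformOf W f)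
    {c : ℚ_[2]} {g : PowerSeries ℤ_[2]} (hg : iwasawaToPowerSeries 2 g = C c * padicLFunction f (unitRoot W 2 : ℚ_[2]))
    {n : ℕ} (hn : HasOrderAtNegTwo g n) :
    (-1 : ℤ) ^ n = W.rootNumber * ZMod.χ₈ ((W.conductorNorm ℤ : ℕ) : ZMod 8) := by
  have hg0 : g ≠ 0 := ne_zero_of_hasOrderAtNegTwo hn
  obtain ⟨e, -, hFE⟩ := exists_integral_functional_equation hord hf hg
  have h2 := neg_one_pow_eq_evalAt_negTwo_of_hasOrderAtNegTwo hFE hn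
  rw [evalAt_negTwo_eq_neg_one_pow_lam_mul_constantCoeff hg0 hFE, constantCoeff_multiplier] at h2
  have hlam := neg_one_pow_lam_eq_χ₈_conductorNorm hord hf hg hg0
  have key : (((-1 : ℤ) ^ n : ℤ) : ℤ_[2]) = ((((-1 : ℤ) ^ lam g * W.rootNumber : ℤ)) : ℤ_[2]) := by
    push_cast; exact h2
  rw [Int.cast_injective key, hlam, mul_comm]

/-- **`λ(g) ≡ ord₀ g + ord₋₂ g (mod 2)`** for the integral models of `c·L₂(W, T)` — the two-fixed-points law of part 2 in this setting
(equivalently `χ₈(N_W) = w(W) · w(W)χ₈(N_W)`). [cite: GreenbergLNM1716, §5 p. 181] -/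
theorem even_lam_add_orderAtZero_add_orderAtNegTwo_of_map_eq (hord : IsOrdinaryAt W 2) (hf : IsNewformOf W f)
    {c : ℚ_[2]} {g : PowerSeries ℤ_[2]} (hg : iwasawaToPowerSeries 2 g = C c * padicLFunction f (unitRoot W 2 : ℚ_[2]))
    {m n : ℕ} (hm : HasOrderAtZero g m) (hn : HasOrderAtNegTwo g n) : Even (lam g + m + n) := by
  obtain ⟨e, -, hFE⟩ := exists_integral_functional_equation hord hf hg
  exact even_lam_add_orderAtZero_add_orderAtNegTwo hFE hm hn

/-! ## §3 Tam-odd curves: the laws keyed on `Δ_min mod 8` -/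

/-- **On Tam-odd curves `(−1)^{ord₋₂ g} = χ₈(|Δ_min|)·w(W)`**: for `W` globally minimal, good ordinary at `2`, with `∏ c_v` odd,
`N_W ≡ |Δ_min| (mod 8)` (att-p5 g32 `natCast_conductorNorm_zmod_eight_eq_abs_minimalDiscriminantInt`, Ogg–Saito + odd-`c_ℓ` Kodaira types).
[cite: SilvermanATAEC1994, IV.9 Table 4.1 and IV.11.1] -/
theorem neg_one_pow_orderAtNegTwo_eq_χ₈_abs_minimalDiscriminantInt_mul (hord : IsOrdinaryAt W 2) (hf : IsNewformOf W f)
    (hodd : Odd W.tamagawaProduct)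
    {c : ℚ_[2]} {g : PowerSeries ℤ_[2]} (hg : iwasawaToPowerSeries 2 g = C c * padicLFunction f (unitRoot W 2 : ℚ_[2]))
    {n : ℕ} (hn : HasOrderAtNegTwo g n) :
    (-1 : ℤ) ^ n = ZMod.χ₈ ((|minimalDiscriminantInt W| : ℤ) : ZMod 8) * W.rootNumber := by
  rw [neg_one_pow_orderAtNegTwo_eq_rootNumber_mul_χ₈ hord hf hg hn,
    natCast_conductorNorm_zmod_eight_eq_abs_minimalDiscriminantInt W hord.1 hodd, mul_comm]

/-- **On Tam-odd curves `(−1)^{λ(g)} = χ₈(|Δ_min|)`**. [cite: SilvermanATAEC1994, IV.9 Table 4.1 and IV.11.1] -/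
theorem neg_one_pow_lam_eq_χ₈_abs_minimalDiscriminantInt (hord : IsOrdinaryAt W 2) (hf : IsNewformOf W f)
    (hodd : Odd W.tamagawaProduct)
    {c : ℚ_[2]} {g : PowerSeries ℤ_[2]} (hg : iwasawaToPowerSeries 2 g = C c * padicLFunction f (unitRoot W 2 : ℚ_[2]))
    (hg0 : g ≠ 0) : (-1 : ℤ) ^ lam g = ZMod.χ₈ ((|minimalDiscriminantInt W| : ℤ) : ZMod 8) := by
  rw [neg_one_pow_lam_eq_χ₈_conductorNorm hord hf hg hg0,
    natCast_conductorNorm_zmod_eight_eq_abs_minimalDiscriminantInt W hord.1 hodd]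

/-- **`(−1)^{ord₋₂ g} = w(W^{(2)})`, the sign of the `χ₈`-twist** (Tam-odd, good ordinary at `2`; modulo the Modularity Theorem in
the tree's form `exists_isNewformOf`, through `rootNumber_quadraticTwist_two`): `2`-adic parity at the order-`2` character.
[cite: MurtyMurty1997, Ch. 6 §1] -/
theorem neg_one_pow_orderAtNegTwo_eq_rootNumber_quadraticTwist_two (hmod : exists_isNewformOf) (hord : IsOrdinaryAt W 2)
    (hf : IsNewformOf W f) (hodd : Odd W.tamagawaProduct)
    {c : ℚ_[2]} {g : PowerSeries ℤ_[2]} (hg : iwasawaToPowerSeries 2 g = C c * padicLFunction f (unitRoot W 2 : ℚ_[2]))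
    {n : ℕ} (hn : HasOrderAtNegTwo g n) : (-1 : ℤ) ^ n = (W.quadraticTwist 2).rootNumber := by
  rw [neg_one_pow_orderAtNegTwo_eq_χ₈_abs_minimalDiscriminantInt_mul hord hf hodd hg hn,
    rootNumber_quadraticTwist_two_eq_χ₈_abs_minimalDiscriminantInt_mul W hmod hord.1 hodd]

/-! ## §4 THE ROAD (`Δ_min ≡ 5 (8)`, and its ramified twin `Δ_min ≡ 3 (8)`): odd order at `T = −2`, `(T+2) ∣ L₂`, odd `λ₂`, even order at `T = 0` -/

/-- **On the cubic Chevalley road the `2`-adic `L`-function vanishes to ODD order at the order-2 character.** For `W/ℚ` globally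
minimal, good ordinary at `2`, `∏ c_v` odd, `Δ_min ≡ 3` or `5 (mod 8)` and `r_an(W) = 0` (so `w(W) = 1`, the tree's unconditional
`rootNumber_eq_one_of_even_analyticRank`), every integral model `g` of `c·L₂(W,T)` has `ord_{T=−2} g` ODD. No interpolation at `χ₈`,
no Modularity hypothesis beyond the newform `f` of `W`, no BSD input. [cite: GreenbergLNM1716, §5 p. 181] -/
theorem odd_orderAtNegTwo_of_road (hord : IsOrdinaryAt W 2) (hf : IsNewformOf W f) (hodd : Odd W.tamagawaProduct)
    (hΔ : minimalDiscriminantInt W % 8 = 3 ∨ minimalDiscriminantInt W % 8 = 5) (hr : W.analyticRank = 0)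
    {c : ℚ_[2]} {g : PowerSeries ℤ_[2]} (hg : iwasawaToPowerSeries 2 g = C c * padicLFunction f (unitRoot W 2 : ℚ_[2]))
    {n : ℕ} (hn : HasOrderAtNegTwo g n) : Odd n := by
  have h := neg_one_pow_orderAtNegTwo_eq_χ₈_abs_minimalDiscriminantInt_mul hord hf hodd hg hn
  have hχ : ZMod.χ₈ ((|minimalDiscriminantInt W| : ℤ) : ZMod 8) = -1 := by
    rcases hΔ with h3 | h5
    · exact χ₈_abs_eq_neg_one_of_emod_eight_eq_three h3
    · exact χ₈_abs_eq_neg_one_of_emod_eight_eq_five h5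
  rw [hχ, rootNumber_eq_one_of_even_analyticRank (W := W) (by rw [hr]; exact Even.zero)] at h
  norm_num at h
  rcases Nat.even_or_odd n with he | ho
  · rw [he.neg_one_pow] at h; norm_num at h
  · exact ho

/-- **`(T + 2) ∣ g` on the road** — the forced zero of `L₂(W, T)` at the first cyclotomic layer `ℚ(√2)`, from the functional equation
ALONE (the tree's `X_add_C_two_dvd_of_analyticRank_quadraticTwist_two_ne_zero` reaches the same divisibility through the MTT
interpolation at `χ₈` and `L(W^{(2)}, 1) = 0`; here neither is used). [cite: GreenbergLNM1716, §5 p. 181] -/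
theorem X_add_C_two_dvd_of_road (hord : IsOrdinaryAt W 2) (hf : IsNewformOf W f) (hodd : Odd W.tamagawaProduct)
    (hΔ : minimalDiscriminantInt W % 8 = 3 ∨ minimalDiscriminantInt W % 8 = 5) (hr : W.analyticRank = 0)
    {c : ℚ_[2]} {g : PowerSeries ℤ_[2]} (hg : iwasawaToPowerSeries 2 g = C c * padicLFunction f (unitRoot W 2 : ℚ_[2])) :
    (X + C (2 : ℤ_[2])) ∣ g := by
  by_cases hg0 : g = 0
  · rw [hg0]; exact dvd_zero _
  obtain ⟨n, hn⟩ := exists_hasOrderAtNegTwo hg0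
  have hpos : 0 < n := (odd_orderAtNegTwo_of_road hord hf hodd hΔ hr hg hn).pos
  exact dvd_trans (dvd_pow_self _ hpos.ne') hn.1

/-- **`λ₂` is ODD on the road**: every non-zero integral model `g` of `c·L₂(W, T)` has odd Weierstrass degree `λ(g)`
(`(−1)^{λ} = χ₈(|Δ_min|) = −1`); with `μ`-invariance of `λ` under scalars this is `λ(L₂(W,T))` odd, hence `≥ 1`, and `≥ 3` as soon as
`ord_{T=−2} = 1` is not the only zero (crux memo CHI8-TWIST-att-p5-g32 §6: λ₂ ∈ {3,5,7,11,15} on 19/19 road curves).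
[cite: GreenbergLNM1716, §5 p. 181] -/
theorem odd_lam_of_road (hord : IsOrdinaryAt W 2) (hf : IsNewformOf W f) (hodd : Odd W.tamagawaProduct)
    (hΔ : minimalDiscriminantInt W % 8 = 3 ∨ minimalDiscriminantInt W % 8 = 5)
    {c : ℚ_[2]} {g : PowerSeries ℤ_[2]} (hg : iwasawaToPowerSeries 2 g = C c * padicLFunction f (unitRoot W 2 : ℚ_[2]))
    (hg0 : g ≠ 0) : Odd (lam g) := by
  have h := neg_one_pow_lam_eq_χ₈_abs_minimalDiscriminantInt hord hf hodd hg hg0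
  have hχ : ZMod.χ₈ ((|minimalDiscriminantInt W| : ℤ) : ZMod 8) = -1 := by
    rcases hΔ with h3 | h5
    · exact χ₈_abs_eq_neg_one_of_emod_eight_eq_three h3
    · exact χ₈_abs_eq_neg_one_of_emod_eight_eq_five h5
  rw [hχ] at h
  rcases Nat.even_or_odd (lam g) with he | ho
  · rw [he.neg_one_pow] at h; norm_num at h
  · exact ho

/-- **Even order at the trivial character on the road** (`w(W) = 1`): `ord_{T=0} g` is even for every integral model `g` of
`c·L₂(W,T)` when `r_an(W) = 0` (with the interpolation property and `L(W,1) ≠ 0` it is `0`; not used here).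
[cite: GreenbergLNM1716, §5 p. 181] -/
theorem even_orderAtZero_of_analyticRank_eq_zero (hord : IsOrdinaryAt W 2) (hf : IsNewformOf W f) (hr : W.analyticRank = 0)
    {c : ℚ_[2]} {g : PowerSeries ℤ_[2]} (hg : iwasawaToPowerSeries 2 g = C c * padicLFunction f (unitRoot W 2 : ℚ_[2]))
    {m : ℕ} (hm : HasOrderAtZero g m) : Even m := by
  have h := neg_one_pow_orderAtZero_eq_rootNumber hord hf hg hm
  rw [rootNumber_eq_one_of_even_analyticRank (W := W) (by rw [hr]; exact Even.zero)] at h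
  rcases Nat.even_or_odd m with he | ho
  · exact he
  · rw [ho.neg_one_pow] at h; norm_num at h

/-- **The absolute statement for `L₂(W, T)` itself.** On the road the integral lift `L₀ ∈ ℤ₂⟦T⟧` of the `2`-adic `L`-function
(`ι L₀ = L₂(W,T)`, tree `exists_iwasawaToPowerSeries_eq_padicLFunction_two_auto`) is divisible by `T + 2`, has odd order at `T = −2`
and odd `λ`: `∃ L₀, ι L₀ = L₂(W,T) ∧ (T+2) ∣ L₀ ∧ (L₀ ≠ 0 → Odd (λ L₀) ∧ ∃ n, HasOrderAtNegTwo L₀ n ∧ Odd n)`.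
[cite: MazurTateTeitelbaum1986Invent, §I.12–I.13] -/
theorem exists_integral_lift_of_road (hord : IsOrdinaryAt W 2) (hf : IsNewformOf W f) (hodd : Odd W.tamagawaProduct)
    (hΔ : minimalDiscriminantInt W % 8 = 3 ∨ minimalDiscriminantInt W % 8 = 5) (hr : W.analyticRank = 0) :
    ∃ L₀ : IwasawaAlgebra 2, iwasawaToPowerSeries 2 L₀ = padicLFunction f (unitRoot W 2 : ℚ_[2]) ∧
      (X + C (2 : ℤ_[2])) ∣ L₀ ∧
      (L₀ ≠ 0 → Odd (lam L₀) ∧ ∃ n, HasOrderAtNegTwo L₀ n ∧ Odd n) := by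
  obtain ⟨L₀, hL₀⟩ := exists_iwasawaToPowerSeries_eq_padicLFunction_two_auto hord hf
  have hg : iwasawaToPowerSeries 2 L₀ = C (1 : ℚ_[2]) * padicLFunction f (unitRoot W 2 : ℚ_[2]) := by
    rw [map_one, one_mul]; exact hL₀
  refine ⟨L₀, hL₀, X_add_C_two_dvd_of_road hord hf hodd hΔ hr hg, fun h0 => ⟨odd_lam_of_road hord hf hodd hΔ hg h0, ?_⟩⟩
  obtain ⟨n, hn⟩ := exists_hasOrderAtNegTwo h0
  exact ⟨n, hn, odd_orderAtNegTwo_of_road hord hf hodd hΔ hr hg hn⟩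

/-! ## §5 In the crux's own vocabulary: the even-branch lifts `IsEvenBranchLiftAtTwo W f G` -/

omit [NeZero (W.conductorNorm ℤ)] in
/-- For `W` good at `2`, an even-branch lift `G` (crux C2's carrier predicate `IsEvenBranchLiftAtTwo W f G`) is the ORDINARY branch:
`W` is good ordinary at `2` and `ι G = L₂(W, T)` (the multiplicative branch is excluded by good reduction, Mathlib
`HasMultiplicativeReduction.not_hasGoodReduction`). [folklore] -/
theorem isOrdinaryAt_and_eq_of_isEvenBranchLiftAtTwo (hgood : W.HasGoodReductionAtPrime 2) {G : IwasawaAlgebra 2}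
    (hG : IsEvenBranchLiftAtTwo W f G) :
    IsOrdinaryAt W 2 ∧ iwasawaToPowerSeries 2 G = C (1 : ℚ_[2]) * padicLFunction f (unitRoot W 2 : ℚ_[2]) := by
  rcases hG with ⟨hord, hG⟩ | ⟨hmult, -⟩
  · exact ⟨hord, by rw [map_one, one_mul]; exact hG⟩
  · exact absurd hgood (WeierstrassCurve.HasMultiplicativeReduction.not_hasGoodReduction (R := ℤ_[2]) hmult)

/-- **C2's analytic `μ`-hypothesis carrier on the road has odd `λ`.** For `W` globally minimal, good at `2`, `∏ c_v` odd,
`Δ_min ≡ 3, 5 (mod 8)`, `f` its newform at level `N_W` and `G` any even-branch lift (`IsEvenBranchLiftAtTwo W f G`, the `G` of crux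
C2's hypothesis `red G ≠ 0`): if `G ≠ 0` then `λ(G)` is odd. [cite: GreenbergLNM1716, §5 p. 181] -/
theorem odd_lam_of_isEvenBranchLiftAtTwo_of_road (hgood : W.HasGoodReductionAtPrime 2) (hf : IsNewformOf W f)
    (hodd : Odd W.tamagawaProduct) (hΔ : minimalDiscriminantInt W % 8 = 3 ∨ minimalDiscriminantInt W % 8 = 5)
    {G : IwasawaAlgebra 2} (hG : IsEvenBranchLiftAtTwo W f G) (hG0 : G ≠ 0) : Odd (lam G) := by
  obtain ⟨hord, hG'⟩ := isOrdinaryAt_and_eq_of_isEvenBranchLiftAtTwo hgood hG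
  exact odd_lam_of_road hord hf hodd hΔ hG' hG0

/-- **`(T + 2) ∣ G` and odd order at `T = −2` for C2's even-branch lift on the road** (`r_an(W) = 0`). [cite: GreenbergLNM1716, §5 p. 181] -/
theorem X_add_C_two_dvd_of_isEvenBranchLiftAtTwo_of_road (hgood : W.HasGoodReductionAtPrime 2) (hf : IsNewformOf W f)
    (hodd : Odd W.tamagawaProduct) (hΔ : minimalDiscriminantInt W % 8 = 3 ∨ minimalDiscriminantInt W % 8 = 5)
    (hr : W.analyticRank = 0) {G : IwasawaAlgebra 2} (hG : IsEvenBranchLiftAtTwo W f G) :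
    (X + C (2 : ℤ_[2])) ∣ G ∧ ∀ n, HasOrderAtNegTwo G n → Odd n := by
  obtain ⟨hord, hG'⟩ := isOrdinaryAt_and_eq_of_isEvenBranchLiftAtTwo hgood hG
  exact ⟨X_add_C_two_dvd_of_road hord hf hodd hΔ hr hG', fun n hn => odd_orderAtNegTwo_of_road hord hf hodd hΔ hr hG' hn⟩

/-- **`μ(G) = 0 ⇒ G` is not a unit and `λ(G) ≥ 1`** for C2's even-branch lift on the road — the first cyclotomic layer is never
`λ`-silent there (crux memo CHI8-TWIST-att-p5-g32 §2). [cite: GreenbergLNM1716, §5 p. 181] -/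
theorem one_le_lam_of_isEvenBranchLiftAtTwo_of_road (hgood : W.HasGoodReductionAtPrime 2) (hf : IsNewformOf W f)
    (hodd : Odd W.tamagawaProduct) (hΔ : minimalDiscriminantInt W % 8 = 3 ∨ minimalDiscriminantInt W % 8 = 5)
    {G : IwasawaAlgebra 2} (hG : IsEvenBranchLiftAtTwo W f G) (hG0 : G ≠ 0) : 1 ≤ lam G :=
  (odd_lam_of_isEvenBranchLiftAtTwo_of_road hgood hf hodd hΔ hG hG0).pos

end Summit.BirchSwinnertonDyer.BirchSwinnertonDyer.Theorems.AlignedTransportAtTwoRoadSecondFixedPoint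

end
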